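/-
Origin: expansion seat `planner-pub-hodgecm-mc-axioms-1-g14-0`, handover #W251 2026-08-20T15:53:55Z md5 9340572961e0 (PKG bba403fefa6e → 9340572961e0; 196 l.; MECHANICAL (iib-R) rewrite v3.1 of the PKG file as it stands (43 token edits; rules R1x1+RX[h₂]x42)) (`HOME/mc/pub-hodgecm-mc-axioms-1-g14/revendor/kit-r55/stage55/HodgeCM/Model/Binders/Real34LocInstance.lean`, md5 9340572961e0, 196 lines);
landed by the gen-22 packager (p-g22) in gate run 55 REPLACES the earlier landed copy of `HodgeCM/Model/Binders/Real34LocInstance.lean` (seat copy carried the packager Origin header of an earlier run (stripped)).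
-/
/-
Origin: speedrun cell pub-hodgecm, MODEL-CONSTRUCTION sub-cell, unit pub-hodgecm-mc-binder-1-g8 (BINDER PROVER gen 8; node
B2-meet, BINDER-OWNERS row 15 `real34`), seat prover-pub-hodgecm-mc-binder-1-g8-0, 2026-08-19.  (W1)+(Θ-sat) world (RUN 37).
Target in PKG: HodgeCM/Model/Binders/Real34LocInstance.lean (NEW additive leaf; imports this lineage's kit #15 ⁗′
`Model/Binders/Real34OfJunctions`, #17 ⁗ `Model/Binders/Real34LocOfThetaGen` and mc-theta-3's #S11 `Model/ThetaGenExports`;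
nothing landed imports it).
KERNEL ONLY: 0 records of published theorems, nothing cited, 0 `def … : Prop`, ONE hypothesis record (`Real34PinJunctions`,
nothing asserted), MODEL-N ±0, E unchanged.
-/
import Summits.HodgeConjecture.HodgeCM.Model.Binders.Real34OfJunctions
import Summits.HodgeConjecture.HodgeCM.Model.Binders.Real34LocOfThetaGen
import Summits.HodgeConjecture.HodgeCM.Model.ThetaGenExports

/-!
# Row `real34`: the junction record `Real34Loc` INSTANTIATED at the pins (`adm := adm₃₄`)

Kit #17 `Real34Loc.ofThetaGen adm hsat hΘge hhol htransl` discharged the three junction fields of the admissible-representative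
record `Real34Loc` (kit #14) from four theta-lane exports stated per admissible `K`-type situation.  mc-theta-3's #S11
`Model/ThetaGenExports` fixes the admissibility predicate of record `adm₃₄` (model1 BINDER-TRIAGE §69.1: saturated at `sat(K_Γ)`,
strict, of holomorphic type) and delivers (T1) `hsat_of_adm₃₄`, (T2) `forms_le_Θ_of_adm₃₄`, (T3) `restrictHom_mem_Hol_of_adm₃₄`
and the (T4) engine `exists_adm₃₄_coe_eq_rightTranslate_of_mem_Gfin` (an admissible situation at the conjugated level containing
the finite-adelic right translate).  This leaf composes:

* § 1 **`htransl_of_exports hGfin hcorr`** — #17's `htransl` binder VERBATIM at `adm := adm₃₄`: #S11's (T4) followed by kit #10's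
  span step `exists_mem_span_thetaGen_coe_eq` (the translate of a theta form of an admissible situation is an admissible candidate).
  Residual hypotheses, both properties of the DATA `S` (model1 §69.2, theta-3 #S11): `hGfin` — the finite ideles `e(1, k_f⁻¹)` lie
  in the pin's finite factor `S.Gfin`; `hcorr` — the saturated compact open of a level absorbs the level up to rational points,
  with correctors centralising `S.ιinf (U(2,1))` (= the (L3) field `rat_split_level` of the next `ThetaAdelicSide` re-cut).
* § 2 **`Real34Loc.ofThetaSat hGfin hcorr : Real34Loc …`** — the record at the pins: `Rep Γ i G := G ∈ span (thetaGen Γ i adm₃₄)`,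
  `sat`/`transl`/`descend` PROVED; `Real34Loc.ofThetaSat_rep_thetaGenElt` — D-6's `hRep` at this record for MATCHED characters
  (definitional), the proviso being (N1)₂,₃ at the (34)-torus index characters.
* § 3 **`Real34PinJunctions`** (hypothesis record: `hGfin`, `hcorr`, (K34) `gen_mem` at `wset := (Real34Loc.ofThetaSat …).wset`,
  D-1′'s `hι`, C3₂,₃ `hU₂ hU₃`), `Real34PinJunctions.toJunctions`, and **`real34_of_thetaSat hpc hcup hph J : ‹E's real34
  VERBATIM›** — row 15 from the residual junctions ONLY: (K34) `gen_mem` [mc-discharge-1 D-6], the two pin-data facts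
  `hGfin`/`hcorr` [the honest `S`], `hι` [D-1′], C3₂,₃ and the universe facts `Fact_pull_comp/cup/hodge`.

Nothing here is a claim of the manuscripts under adjudication.
-/

set_option autoImplicit false

noncomputable section

open MeasureTheory NumberField
open scoped InnerProductSpace

namespace HodgeCM.Model

open HodgeCM HodgeCM.Universe
open Literature.Geometry.ComplexHyperbolic.BallModel (U21)
open Literature.NumberTheory.Weil1964
open Literature.NumberTheory.Automorphic (weightForms)
open Literature.NumberTheory.Automorphic.WeightForms (ClassMapDatum thetaClasses restrictHom IsLevelCorrected IsWeightMatched)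
open Literature.NumberTheory.Automorphic.LevelOrbit (conjLevel)
open Literature.NumberTheory.Automorphic.UnitaryGroup
open Literature.AlgebraicGeometry.HodgeTheory
open Literature.NumberTheory.Automorphic.PicardCM
open Literature.NumberTheory.Transcendental (Arapura2012_Cor_15_4_6)
open HodgeCM.Model.ThetaSpace
open HodgeCM.Model.SupplyResidual (WeilPairData.charInv WeilPairData.charInv_mem_weightFunctions)

variable (hHD : exists_isReal_hodgeModel) (hI : hodgePQ_independent_of_hodgeModel)
  (h₁ : BallQuotientUniformised)  (h₃ : CMAbelianVarietyRealised)
variable (h : Bool) (hA : Arapura2012_Cor_15_4_6)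
  (W : ∀ {L : CMField} {ι₁ : L →+* ℂ} (V : HermSpace3 L ι₁) (c : SeesawCtx L), WmInput V c.D)
  (S : ∀ {L : CMField} {ι₁ : L →+* ℂ} (V : HermSpace3 L ι₁) (c : SeesawCtx L), ThetaAdelicSide V c)
  (μ : ∀ {L : CMField}, SeesawCtx L → Fin 4 → InfinitePlace L → ℤ)
variable {L : CMField} {ι₁ : L →+* ℂ} (V : HermSpace3 L ι₁) (c : SeesawCtx L) (hV : IsAnisotropic L V.Hm)

/-- the pinned theta-space INPUT of the context (kit #2 `pinX`) -/
local notation3 "𝕏" => pinX hHD hI h₁ h₃ S V c hV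

/-! ## 1. (T4) `htransl` at `adm₃₄` from the theta-lane exports -/

/-- **(T4) `htransl` of `Real34Loc.ofThetaGen` at `adm := adm₃₄`** — #S11 `exists_adm₃₄_coe_eq_rightTranslate_of_mem_Gfin` (an
admissible situation at the conjugated level containing the translate) followed by kit #10 `exists_mem_span_thetaGen_coe_eq` (its theta
forms are admissible candidates).  Hypotheses: `hGfin` (the finite ideles lie in `S.Gfin`) and `hcorr` (level correctors inside the
saturation subgroup) — properties of the data `S`. -/
theorem htransl_of_exports
    (hGfin : ∀ kf : V.adelicFin, finTranslate V hV kf ∈ (S V c).Gfin)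
    (hcorr : ∀ (Γ : Level V), ∀ δ ∈ levelImage hHD hI h₁ h₃ Γ hV,
      ∃ x : (V.latticeModel printFact_unitaryCompact_holds).G, x ∈ satLevelRegimeOf V hV Γ.K ∧
        (S V c).ιinf δ * x ∈ (V.latticeModel printFact_unitaryCompact_holds).Γ ∧ ∀ y : U21, Commute x ((S V c).ιinf y)) :
    ∀ (Γ' Γ : Level V) (k : Fin 4) (Sit : KTypeSituation ((𝕏).P k) ((𝕏).ιinf Γ') ((𝕏).Δ Γ') (𝕏).κ₁ (𝕏).τ₁)
        (kf : finAdelic (↥(maximalRealSubfield L)) L (IsCMField.complexConj L) 3 V.Hm),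
      adm₃₄ hHD hI h₁ h₃ (S V c) hV Γ' k Sit →
      Γ.K ≤ conjLevel Γ'.K kf⁻¹ →
      ∀ θ ∈ Sit.thetaForms ((𝕏).P k).weightFunctions,
        ∃ G ∈ Submodule.span ℂ (thetaGen hHD hI h₁ h₃ S V c hV Γ k (adm₃₄ hHD hI h₁ h₃ (S V c) hV Γ k)),
          (G : (quotU V).G → (Fin 2 → ℂ)) =
            fun g : (quotU V).G => (θ : (𝕏).GU → (𝕏).W)
              ((g * regimeEquivT V hV ((cmAdelicProdEquiv (L : Type) 3 V.Hm).symm (1, kf⁻¹)) : (quotU V).G)) := by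
  intro Γ' Γ k Sit kf hadm hle θ hθ
  obtain ⟨Sit', hadm', θ', hθ', hcoe⟩ := exists_adm₃₄_coe_eq_rightTranslate_of_mem_Gfin hHD hI h₁ h₃ (S V c) hV Γ' Γ k
    Sit kf hle (hGfin kf) (hcorr Γ) hadm θ hθ
  obtain ⟨G, hG, hGcoe⟩ := exists_mem_span_thetaGen_coe_eq hHD hI h₁ h₃ S V c hV
    (adm₃₄ hHD hI h₁ h₃ (S V c) hV) Γ k Sit' hadm' hθ'
  exact ⟨G, hG, hGcoe.trans hcoe⟩

/-! ## 2. The record at the pins -/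

/-- **`Real34Loc` at the pins** (`adm := adm₃₄`): `Rep Γ i G := G ∈ span (thetaGen Γ i adm₃₄)`, the fields `sat` / `transl` / `descend`
discharged by kit #17 from #S11's (T1)–(T4); hypotheses `hGfin`, `hcorr` only. -/
def Real34Loc.ofThetaSat
    (hGfin : ∀ kf : V.adelicFin, finTranslate V hV kf ∈ (S V c).Gfin)
    (hcorr : ∀ (Γ : Level V), ∀ δ ∈ levelImage hHD hI h₁ h₃ Γ hV,
      ∃ x : (V.latticeModel printFact_unitaryCompact_holds).G, x ∈ satLevelRegimeOf V hV Γ.K ∧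
        (S V c).ιinf δ * x ∈ (V.latticeModel printFact_unitaryCompact_holds).Γ ∧ ∀ y : U21, Commute x ((S V c).ιinf y)) :
    Real34Loc hHD hI h₁ h₃ h hA W S μ V c hV :=
  Real34Loc.ofThetaGen hHD hI h₁ h₃ h hA W S μ V c hV (adm₃₄ hHD hI h₁ h₃ (S V c) hV)
    (fun Γ k Sit hadm => hsat_of_adm₃₄ hHD hI h₁ h₃ (S V c) hV Γ k Sit hadm)
    (fun Γ k Sit hadm => forms_le_Θ_of_adm₃₄ hHD hI h₁ h₃ (S V c) hV Γ k Sit hadm)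
    (fun Γ k Sit hadm => restrictHom_mem_Hol_of_adm₃₄ hHD hI h₁ h₃ (S V c) hV Γ k Sit hadm)
    (htransl_of_exports hHD hI h₁ h₃ S V c hV hGfin hcorr)

/-- **(K34) `hRep` at the pinned record, MATCHED characters** — the hypothesis `hRep` of mc-discharge-1's
`Real34Loc.gen_mem_of_kType` / `nonempty_junctions_of_kType` (D-6 `Model/Binders/Real34GenMem`) at `J := Real34Loc.ofThetaSat …`:
every generating theta form `θ(j, χ'⁻¹)` of an `adm₃₄`-admissible situation is `Rep`-admissible PROVIDED `χ'` has the archimedean type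
of the line (`χ'(t_∞) · ((𝕏).P k).w t = 1`, i.e. `charInv χ' ∈ ((𝕏).P k).weightFunctions`) — definitional (`Submodule.subset_span ∘
thetaGenElt_mem`).  For the (34)-torus index characters `χ : ((pinT …).t34 V c).X` the proviso for `charFst χ.1` / `charSnd χ.1` follows
from (N1)₂,₃ `((S V c).P k).w = ⇑(archWeight L (μ c k))` by `WeilPairData.residualType_iff_hasArchType_neg` + `mem_allowedChars` +
`d34Of_m₁`/`d34Of_m₂` (kit #9's (N1) mechanism at lines `2, 3`). -/
theorem Real34Loc.ofThetaSat_rep_thetaGenElt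
    (hGfin : ∀ kf : V.adelicFin, finTranslate V hV kf ∈ (S V c).Gfin)
    (hcorr : ∀ (Γ : Level V), ∀ δ ∈ levelImage hHD hI h₁ h₃ Γ hV,
      ∃ x : (V.latticeModel printFact_unitaryCompact_holds).G, x ∈ satLevelRegimeOf V hV Γ.K ∧
        (S V c).ιinf δ * x ∈ (V.latticeModel printFact_unitaryCompact_holds).Γ ∧ ∀ y : U21, Commute x ((S V c).ιinf y)) :
    ∀ (Γ₀ : Level V) (k : Fin 4) (Sit : KTypeSituation ((𝕏).P k) ((𝕏).ιinf Γ₀) ((𝕏).Δ Γ₀) (𝕏).κ₁ (𝕏).τ₁),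
      adm₃₄ hHD hI h₁ h₃ (S V c) hV Γ₀ k Sit → ∀ j ∈ Sit.𝓙,
        ∀ χ' : PontryaginDual (Literature.NumberTheory.Automorphic.relNormOneIdeles (𝕏).K (𝕏).L ⧸
          Literature.NumberTheory.Automorphic.relNormOneRat (𝕏).K (𝕏).L),
        (∀ t : Literature.NumberTheory.Automorphic.relNormOneInfUnits (𝕏).K (𝕏).L,
          ((χ' ((Literature.NumberTheory.Automorphic.relNormOneInfToIdeles (𝕏).K (𝕏).L t :
              Literature.NumberTheory.Automorphic.relNormOneIdeles (𝕏).K (𝕏).L) :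
            Literature.NumberTheory.Automorphic.relNormOneIdeles (𝕏).K (𝕏).L ⧸
              Literature.NumberTheory.Automorphic.relNormOneRat (𝕏).K (𝕏).L) : Circle) : ℂ) * ((𝕏).P k).w t = 1) →
        (Real34Loc.ofThetaSat hHD hI h₁ h₃ h hA W S μ V c hV hGfin hcorr).Rep Γ₀ k
          (thetaGenElt hHD hI h₁ h₃ S V c hV Γ₀ k Sit j (WeilPairData.charInv χ')) :=
  fun Γ₀ k Sit hadm _ hj _ hχ' =>
    Submodule.subset_span (thetaGenElt_mem hHD hI h₁ h₃ S V c hV Γ₀ k Sit hj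
      (WeilPairData.charInv_mem_weightFunctions hχ') hadm)

/-! ## 3. Row 15 from the residual junctions -/

/-- **The residual (34) junctions of the context `(V, c)` at the pins** (regime `hV`): the two pin-data facts `hGfin`/`hcorr`, (K34)
`gen_mem` at the wset of `Real34Loc.ofThetaSat`, D-1′'s frame junction `hι` and C3 for the types `2, 3`.  A HYPOTHESIS record; nothing
asserted. -/
structure Real34PinJunctions where
  /-- the finite ideles `e(1, k_f⁻¹)` lie in the pin's finite factor -/
  hGfin : ∀ kf : V.adelicFin, finTranslate V hV kf ∈ (S V c).Gfin
  /-- level correctors inside the saturation subgroup ((L3) `rat_split_level`) -/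
  hcorr : ∀ (Γ : Level V), ∀ δ ∈ levelImage hHD hI h₁ h₃ Γ hV,
    ∃ x : (V.latticeModel printFact_unitaryCompact_holds).G, x ∈ satLevelRegimeOf V hV Γ.K ∧
      (S V c).ιinf δ * x ∈ (V.latticeModel printFact_unitaryCompact_holds).Γ ∧ ∀ y : U21, Commute x ((S V c).ιinf y)
  /-- (K34) PerL Lemma 3.5 (34), FUNCTION form, at the wset of the pinned record -/
  gen_mem : ∀ (χ : ((pinT hHD hI h₁ h₃ h hA W S μ).t34 V c).X) (Φ : (pinT hHD hI h₁ h₃ h hA W S μ).SK V c),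
    ((pinT hHD hI h₁ h₃ h hA W S μ).t34 V c).ϑ χ Φ ∈
      (Submodule.span ℂ (Real34Loc.ofThetaSat hHD hI h₁ h₃ h hA W S μ V c hV hGfin hcorr).wset).topologicalClosure
  /-- (D-1′) the archimedean component of `S` is the section at `ι₁` in the uniform Sylvester frame -/
  hι : ∀ u : U21, (S V c).ιinf u =
    Adelic.regimeEquiv L V.Hm hV (archSectionU21CM (L : Type) ι₁ V.Hm V.sylvesterFrame (sylvesterFrame_J V) u)
  /-- C3 for type `2` -/
  hU₂ : ∀ Γ : Level V, (pinT hHD hI h₁ h₃ h hA W S μ).Theta V c 2 Γ ⊆ (picardCMUniverse hHD hI h₁ h₃).Uiso Γ c.K (c.Ψ 2) c.σ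
  /-- C3 for type `3` -/
  hU₃ : ∀ Γ : Level V, (pinT hHD hI h₁ h₃ h hA W S μ).Theta V c 3 Γ ⊆ (picardCMUniverse hHD hI h₁ h₃).Uiso Γ c.K (c.Ψ 3) c.σ

/-- The residual junctions assemble the (34) junction record of kit #15 at the pinned `Real34Loc`. -/
def Real34PinJunctions.toJunctions {hHD hI h₁ h₃ h hA W S μ} {V : HermSpace3 L ι₁} {c : SeesawCtx L} {hV : IsAnisotropic L V.Hm}
    (J : Real34PinJunctions hHD hI h₁ h₃ h hA W S μ V c hV) : Real34Junctions hHD hI h₁ h₃ h hA W S μ V c hV where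
  toReal34Loc := Real34Loc.ofThetaSat hHD hI h₁ h₃ h hA W S μ V c hV J.hGfin J.hcorr
  gen_mem := J.gen_mem
  hι := J.hι
  hU₂ := J.hU₂
  hU₃ := J.hU₃

/-- **E's binder `real34` IN ITS QUANTIFIED FORM from the residual junctions at the pins**: at every good sextic context (regime
`hV := isAnisotropic_of_goodCtx`), (K34) `gen_mem`, the pin-data facts `hGfin`/`hcorr`, `hι`, C3₂,₃ — together with the universe facts
`Fact_pull_comp` / `Fact_pull_cup` / `Fact_pull_hodge` — give `Nonempty (Real34FunBridge V c)`.  The meeting step (L-loc), (E3), (J-cov′)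
and the theta-lane exports (T1)–(T4) are all kernel-discharged below this line. -/
theorem real34_of_thetaSat (hpc : (picardCMUniverse hHD hI h₁ h₃).Fact_pull_comp)
    (hcup : (picardCMUniverse hHD hI h₁ h₃).Fact_pull_cup) (hph : (picardCMUniverse hHD hI h₁ h₃).Fact_pull_hodge)
    (J : ∀ {L : CMField} {ι₁ : L →+* ℂ} (V : HermSpace3 L ι₁) (c : SeesawCtx L) (hV : IsAnisotropic L V.Hm),
      (pinT hHD hI h₁ h₃ h hA W S μ).GoodCtx ι₁ c → Module.finrank ℚ c.K = 6 →
        Real34PinJunctions hHD hI h₁ h₃ h hA W S μ V c hV)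
    {L : CMField} {ι₁ : L →+* ℂ} (V : HermSpace3 L ι₁) (c : SeesawCtx L)
    (hc : (pinT hHD hI h₁ h₃ h hA W S μ).GoodCtx ι₁ c) (hK : Module.finrank ℚ c.K = 6) :
    Nonempty ((pinT hHD hI h₁ h₃ h hA W S μ).Real34FunBridge V c) :=
  real34_of_loc hHD hI h₁ h₃ h hA W S μ hpc hcup hph (fun V c hV hc hK => (J V c hV hc hK).toJunctions) V c hc hK

end HodgeCM.Model

end
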